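import Summits.Ventures.YMGap.RobustBall.MassGapOnBall
import HarnessLib

/-!
# Venture YMGap, track ROBUST-BALL — the `ℤ^d` mass gap from ANY robust one-link door

HONEST FRAMING. WHAT THIS IS: a venture file (cell `pub-ymgap`, track Y2 ROBUST-BALL, seat rb-p1): the
GENERIC conclusions layer of the `ℤ^d` robust-ball chain. Given ANY Dobrushin condition in the
Vasserstein form for the perturbed `SU(N)` specification over its natural range —
`IsKRContraction (perturbedYM (fundamentalRep (Fin N)) (N β) W supp) suFrobDist (perturbedNbr supp) C`
with row sums `∑_{y} C x y ≤ ρ < 1` — it delivers (i) DLR uniqueness, (ii) Shen–Zhu–Zhu clustering with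
the explicit rate `-log max(ρ, 1/2) / max(1, R)` (`R` the `ℓ^∞` range of `W`), and (iii) for continuous
terms the packaged `PerturbedMassGapAt d N β W supp` (existence from `PerturbedExistence.lean`). The
Poincaré/variance door of `RobustMassGapDoor.lean` is ONE producer of such an `IsKRContraction`
(`isKRContraction_perturbedYM_SU`); a Kantorovich–Rubinstein-MODULUS door (ds-4's tilt-stability
transfer with the `SU(2)` quarter modulus), or any future certified one-link input, is another — each
plugs in here by proving only its contraction estimate through `isKRContraction_perturbedYM`
(`PerturbedOneLink.lean`). WHAT THIS IS NOT: no new door, no number; lattice strong-coupling statement;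
no continuum / Millennium claim.
-/

noncomputable section

open MeasureTheory Filter Function ProbabilityTheory Real
open scoped NNReal
open Literature.Probability.LatticeModels
open Literature.Probability.LatticeModels.DobrushinMetric
open Literature.MathematicalPhysics.QuantumLattice
open Literature.MathematicalPhysics.QuantumFieldTheory hiding ZdEdge

namespace Summit.Ventures.YMGap.RobustBall

variable {d N : ℕ}

/-- **(i) Uniqueness from any robust door**: an `IsKRContraction` of the perturbed `SU(N)` specification
over `perturbedNbr supp` with row sums `≤ ρ < 1` gives at most one DLR state (tree
`subsingleton_gibbsMeasures_of_isKRContraction`, Frobenius weight, `R = 2√N`, `A = 1`). -/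
theorem subsingleton_perturbedGibbsMeasures_of_isKRContraction (hd : 1 ≤ d) {β ρ : ℝ}
    {W : Potential (ZdEdge d) (Matrix.specialUnitaryGroup (Fin N) ℂ)} (hW : W.IsAdapted)
    (hWb : ∀ X, ∃ C, ∀ U, |W X U| ≤ C)
    {supp : Finset (ZdEdge d) → Finset (Finset (ZdEdge d))} (hsupp : W.IsSupportedBy supp)
    {C : ZdEdge d → ZdEdge d → ℝ}
    (hKR : IsKRContraction (perturbedYM (d := d) (fundamentalRep (Fin N)) (N * β) W supp) suFrobDist
      (perturbedNbr supp) C)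
    (hrow : ∀ x, ∑ y ∈ perturbedNbr supp x, C x y ≤ ρ) (hρ : ρ < 1) :
    (perturbedGibbsMeasures (d := d) (fundamentalRep (Fin N)) (N * β) W supp).Subsingleton := by
  haveI : SecondCountableTopology (Matrix (Fin N) (Fin N) ℂ) :=
    inferInstanceAs (SecondCountableTopology (Fin N → Fin N → ℂ))
  haveI : SecondCountableTopology (Matrix.specialUnitaryGroup (Fin N) ℂ) :=
    Topology.IsEmbedding.subtypeVal.secondCountableTopology
  have hγ : IsSpecification (perturbedYM (d := d) (fundamentalRep (Fin N)) (N * β) W supp) :=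
    isSpecification_perturbedYM _ (continuous_fundamentalRep (Fin N)) _ hW hWb hsupp
  have hρ0 : 0 ≤ ρ := by
    have hd0 : 0 < d := hd
    let e₀ : ZdEdge d := (0, ⟨0, hd0⟩)
    exact (Finset.sum_nonneg fun y _ => hKR.nonneg e₀ y).trans (hrow e₀)
  exact subsingleton_gibbsMeasures_of_isKRContraction hγ hKR (fun _ _ => suFrobDist_nonneg _ _)
    suFrobDist_le suEntries measurableSpace_specialUnitaryGroup_eq_comap zero_le_one
    (fun a b => by rw [one_mul]; exact dist_suEntries_le_suFrobDist a b) hρ0 hρ hrow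

/-- **(ii) Exponential clustering from any robust door**, explicit rate: under the hypotheses of (i)
and the range bound `‖e - y‖_∞ ≤ R` on the listed sets through `e`, every DLR state `μ` satisfies
`|cov_μ(F₁, F₂)| ≤ 2(2√N)² n² e^{κ} · e^{-(κ/R₀) d(Λ₁, Λ₂)} (K₁ K₂ + ‖F₁‖₂ ‖F₂‖₂)` for Lipschitz cylinder
functions with supports `|Λᵢ| ≤ n`, `κ = -log max(ρ, 1/2)`, `R₀ = max(1, R)`. -/
theorem perturbed_covariance_decay_of_isKRContraction {β ρ R : ℝ}
    {W : Potential (ZdEdge d) (Matrix.specialUnitaryGroup (Fin N) ℂ)} (hW : W.IsAdapted)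
    (hWb : ∀ X, ∃ C, ∀ U, |W X U| ≤ C)
    {supp : Finset (ZdEdge d) → Finset (Finset (ZdEdge d))} (hsupp : W.IsSupportedBy supp)
    {C : ZdEdge d → ZdEdge d → ℝ}
    (hKR : IsKRContraction (perturbedYM (d := d) (fundamentalRep (Fin N)) (N * β) W supp) suFrobDist
      (perturbedNbr supp) C)
    (hrow : ∀ x, ∑ y ∈ perturbedNbr supp x, C x y ≤ ρ) (hρ : ρ < 1)
    (hR : ∀ e, ∀ X ∈ supp {e}, e ∈ X → ∀ y ∈ X, ‖e.1 - y.1‖ ≤ R)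
    (μ : Measure (LGConfig d (Matrix.specialUnitaryGroup (Fin N) ℂ)))
    (hμ : μ ∈ perturbedGibbsMeasures (d := d) (fundamentalRep (Fin N)) (N * β) W supp) (n : ℕ) :
    ∀ (F₁ F₂ : LGConfig d (Matrix.specialUnitaryGroup (Fin N) ℂ) → ℝ) (Λ₁ Λ₂ : Finset (ZdEdge d))
      (K₁ K₂ : ℝ≥0), Λ₁.card ≤ n → Λ₂.card ≤ n → Disjoint Λ₁ Λ₂ →
      IsLipschitzCylinder (fundamentalRep (Fin N)) F₁ Λ₁ K₁ →
      IsLipschitzCylinder (fundamentalRep (Fin N)) F₂ Λ₂ K₂ →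
        |cov[F₁, F₂; μ]| ≤
          (2 * (2 * Real.sqrt N) ^ 2 * (n : ℝ) ^ 2 * exp (-Real.log (max ρ (1 / 2)))) *
            exp (-(-Real.log (max ρ (1 / 2)) / max 1 R) * setDistEdges Λ₁ Λ₂) *
            ((K₁ : ℝ) * K₂ + Real.sqrt (∫ U, F₁ U ^ 2 ∂μ) * Real.sqrt (∫ U, F₂ U ^ 2 ∂μ)) := by
  classical
  intro F₁ F₂ Λ₁ Λ₂ K₁ K₂ h₁ h₂ _ hF₁ hF₂
  haveI : SecondCountableTopology (Matrix (Fin N) (Fin N) ℂ) :=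
    inferInstanceAs (SecondCountableTopology (Fin N → Fin N → ℂ))
  haveI : SecondCountableTopology (Matrix.specialUnitaryGroup (Fin N) ℂ) :=
    Topology.IsEmbedding.subtypeVal.secondCountableTopology
  have hγ : IsSpecification (perturbedYM (d := d) (fundamentalRep (Fin N)) (N * β) W supp) :=
    isSpecification_perturbedYM _ (continuous_fundamentalRep (Fin N)) _ hW hWb hsupp
  set c' : ℝ := max ρ (1 / 2) with hc'
  have hc'0 : 0 < c' := lt_max_of_lt_right (by norm_num)
  have hc'1 : c' < 1 := max_lt hρ (by norm_num)
  have hrow' : ∀ x, ∑ y ∈ perturbedNbr supp x, C x y ≤ c' := fun x => (hrow x).trans (le_max_left _ _)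
  set κ : ℝ := -Real.log c' with hκ
  have hκ0 : 0 < κ := neg_pos.2 (Real.log_neg hc'0 hc'1)
  set R₀ : ℝ := max 1 R with hR₀
  have hR₀1 : 1 ≤ R₀ := le_max_left _ _
  have hR₀0 : 0 < R₀ := zero_lt_one.trans_le hR₀1
  have hRsqrt : (0 : ℝ) ≤ 2 * Real.sqrt N := by positivity
  have hμ' : IsGibbsMeasure (perturbedYM (d := d) (fundamentalRep (Fin N)) (N * β) W supp) μ := hμ
  haveI := hμ'.isProbabilityMeasure
  have hnbr : ∀ x, ∀ y ∈ perturbedNbr supp x, ‖x.1 - y.1‖ ≤ R₀ := by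
    intro x y hy
    rcases (mem_perturbedNbr_iff.1 hy).2 with hy' | ⟨X, hX, hxX, hyX⟩
    · exact (norm_sub_le_one_of_mem_linkPlaqNbr hy').trans hR₀1
    · exact (hR x X hX hxX y hyX).trans (le_max_right _ _)
  set ℓ : ZdEdge d → ℕ := fun y => ⌊linkSetDist Λ₂ y / R₀⌋₊ with hℓ
  have hℓ0 : ∀ y ∈ Λ₂, ℓ y = 0 := fun y hy => by simp [hℓ, linkSetDist_eq_zero_of_mem hy]
  have hℓ1 : ∀ x ∉ Λ₂, ∀ y ∈ perturbedNbr supp x, ℓ x ≤ ℓ y + 1 := fun x _ y hy => by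
    have h1 : linkSetDist Λ₂ x / R₀ ≤ linkSetDist Λ₂ y / R₀ + 1 := by
      rw [div_add_one hR₀0.ne', div_le_div_iff_of_pos_right hR₀0]
      exact (linkSetDist_le_add_norm Λ₂ x y).trans (add_le_add_right (hnbr x y hy) _)
    calc ℓ x ≤ ⌊linkSetDist Λ₂ y / R₀ + 1⌋₊ := Nat.floor_mono h1
      _ = ℓ y + 1 := Nat.floor_add_one (div_nonneg (linkSetDist_nonneg _ _) hR₀0.le)
  have key := abs_covariance_le_of_isKRContraction hγ hKR (fun _ _ => suFrobDist_nonneg _ _)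
    suFrobDist_le hRsqrt hc'0.le hc'1.le hrow' hμ'
    hF₁.measurable hF₁.dependsOn hF₁.abs_le
    (hF₁.isLipBound zero_le_one (fun a b => by rw [one_mul]; exact dist_suEntries_le_suFrobDist a b))
    hF₂.measurable hF₂.dependsOn hF₂.abs_le
    (hF₂.isLipBound zero_le_one (fun a b => by rw [one_mul]; exact dist_suEntries_le_suFrobDist a b))
    ℓ hℓ0 hℓ1
  have hK₁ : (0 : ℝ) ≤ K₁ := K₁.2
  have hK₂ : (0 : ℝ) ≤ K₂ := K₂.2
  have hn₁ : (Λ₁.card : ℝ) ≤ n := by exact_mod_cast h₁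
  have hn₂ : (Λ₂.card : ℝ) ≤ n := by exact_mod_cast h₂
  have hsum₂ : ∑ y ∈ Λ₂, (if y ∈ Λ₂ then 1 * (K₂ : ℝ) else 0) ≤ n * K₂ := by
    rw [Finset.sum_ite_of_true (fun y hy => hy), Finset.sum_const, nsmul_eq_mul, one_mul]
    exact mul_le_mul_of_nonneg_right hn₂ hK₂
  have hm : ∀ y ∈ Λ₁, ⌊setDistEdges Λ₁ Λ₂ / R₀⌋₊ ≤ ℓ y := fun y hy =>
    Nat.floor_mono (div_le_div_of_nonneg_right (setDistEdges_le_linkSetDist hy) hR₀0.le)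
  have hsum₁ : ∑ y ∈ Λ₁, c' ^ ℓ y * (if y ∈ Λ₁ then 1 * (K₁ : ℝ) else 0) ≤
      n * (c' ^ ⌊setDistEdges Λ₁ Λ₂ / R₀⌋₊ * K₁) := by
    calc ∑ y ∈ Λ₁, c' ^ ℓ y * (if y ∈ Λ₁ then 1 * (K₁ : ℝ) else 0)
        ≤ ∑ y ∈ Λ₁, c' ^ ⌊setDistEdges Λ₁ Λ₂ / R₀⌋₊ * K₁ := Finset.sum_le_sum fun y hy => by
          rw [if_pos hy, one_mul]
          exact mul_le_mul_of_nonneg_right (pow_le_pow_of_le_one hc'0.le hc'1.le (hm y hy)) hK₁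
      _ = Λ₁.card * (c' ^ ⌊setDistEdges Λ₁ Λ₂ / R₀⌋₊ * K₁) := by rw [Finset.sum_const, nsmul_eq_mul]
      _ ≤ n * (c' ^ ⌊setDistEdges Λ₁ Λ₂ / R₀⌋₊ * K₁) :=
          mul_le_mul_of_nonneg_right hn₁ (by positivity)
  have hgeom : c' ^ ⌊setDistEdges Λ₁ Λ₂ / R₀⌋₊ ≤
      exp κ * exp (-(κ / R₀) * setDistEdges Λ₁ Λ₂) := by
    have hfl : setDistEdges Λ₁ Λ₂ / R₀ - 1 ≤ (⌊setDistEdges Λ₁ Λ₂ / R₀⌋₊ : ℝ) := by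
      have := Nat.lt_floor_add_one (setDistEdges Λ₁ Λ₂ / R₀)
      linarith
    rw [← exp_add, ← Real.rpow_natCast, Real.rpow_def_of_pos hc'0]
    refine exp_le_exp.2 ?_
    have hlog : Real.log c' = -κ := by rw [hκ, neg_neg]
    rw [hlog]
    have := mul_le_mul_of_nonneg_left hfl hκ0.le
    have e1 : -(κ / R₀) * setDistEdges Λ₁ Λ₂ = -(κ * (setDistEdges Λ₁ Λ₂ / R₀)) := by
      field_simp
    rw [e1]
    linarith
  calc |cov[F₁, F₂; μ]|
      ≤ 2 * (2 * Real.sqrt N) ^ 2 * (∑ y ∈ Λ₂, (if y ∈ Λ₂ then 1 * (K₂ : ℝ) else 0)) *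
          ∑ y ∈ Λ₁, c' ^ ℓ y * (if y ∈ Λ₁ then 1 * (K₁ : ℝ) else 0) := key
    _ ≤ 2 * (2 * Real.sqrt N) ^ 2 * (n * K₂) * (n * (c' ^ ⌊setDistEdges Λ₁ Λ₂ / R₀⌋₊ * K₁)) := by
        refine mul_le_mul (mul_le_mul_of_nonneg_left hsum₂ (by positivity)) hsum₁
          (Finset.sum_nonneg fun y hy => ?_) (by positivity)
        rw [if_pos hy]; positivity
    _ ≤ 2 * (2 * Real.sqrt N) ^ 2 * (n * K₂) *
          (n * (exp κ * exp (-(κ / R₀) * setDistEdges Λ₁ Λ₂) * K₁)) := by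
        gcongr
    _ = 2 * (2 * Real.sqrt N) ^ 2 * (n : ℝ) ^ 2 * exp κ * exp (-(κ / R₀) * setDistEdges Λ₁ Λ₂) *
          ((K₁ : ℝ) * K₂) := by ring
    _ ≤ 2 * (2 * Real.sqrt N) ^ 2 * (n : ℝ) ^ 2 * exp κ * exp (-(κ / R₀) * setDistEdges Λ₁ Λ₂) *
          ((K₁ : ℝ) * K₂ + Real.sqrt (∫ U, F₁ U ^ 2 ∂μ) * Real.sqrt (∫ U, F₂ U ^ 2 ∂μ)) := by
        gcongr
        exact le_add_of_nonneg_right (by positivity)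

/-- **(iii) The packaged mass gap of the member from ANY robust door**: for a member with continuous
terms depending only on their own links, supported by `supp` with range `R`, an `IsKRContraction` of its
`SU(N)` specification over `perturbedNbr supp` with row sums `≤ ρ < 1` gives
`PerturbedMassGapAt d N β W supp` — uniqueness (i), existence (`perturbedGibbsMeasures_nonempty`),
clustering (ii). The plug for every one-link door on `ℤ^d`. -/
theorem perturbedMassGapAt_of_isKRContraction (hd : 1 ≤ d) {β ρ R : ℝ}
    {W : Potential (ZdEdge d) (Matrix.specialUnitaryGroup (Fin N) ℂ)} (hWc : ∀ X, Continuous (W X))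
    (hWdep : ∀ X, DependsOn (W X) (↑X : Set (ZdEdge d)))
    {supp : Finset (ZdEdge d) → Finset (Finset (ZdEdge d))} (hsupp : W.IsSupportedBy supp)
    {C : ZdEdge d → ZdEdge d → ℝ}
    (hKR : IsKRContraction (perturbedYM (d := d) (fundamentalRep (Fin N)) (N * β) W supp) suFrobDist
      (perturbedNbr supp) C)
    (hrow : ∀ x, ∑ y ∈ perturbedNbr supp x, C x y ≤ ρ) (hρ : ρ < 1)
    (hR : ∀ e, ∀ X ∈ supp {e}, e ∈ X → ∀ y ∈ X, ‖e.1 - y.1‖ ≤ R) :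
    PerturbedMassGapAt d N β W supp := by
  haveI : SecondCountableTopology (Matrix (Fin N) (Fin N) ℂ) :=
    inferInstanceAs (SecondCountableTopology (Fin N → Fin N → ℂ))
  haveI : SecondCountableTopology (Matrix.specialUnitaryGroup (Fin N) ℂ) :=
    Topology.IsEmbedding.subtypeVal.secondCountableTopology
  have hW : W.IsAdapted := fun X => ⟨hWdep X, (hWc X).measurable⟩
  have hWb : ∀ X, ∃ C, ∀ U, |W X U| ≤ C := fun X => exists_bound_of_continuous (hWc X)
  refine ⟨⟨subsingleton_perturbedGibbsMeasures_of_isKRContraction hd hW hWb hsupp hKR hrow hρ,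
      perturbedGibbsMeasures_nonempty _ (continuous_fundamentalRep (Fin N)) _ hWc hWdep hsupp⟩,
    fun μ hμ => ?_⟩
  have hc'0 : 0 < max ρ (1 / 2) := lt_max_of_lt_right (by norm_num)
  have hc'1 : max ρ (1 / 2) < 1 := max_lt hρ (by norm_num)
  have hκ0 : 0 < -Real.log (max ρ (1 / 2)) := neg_pos.2 (Real.log_neg hc'0 hc'1)
  have hR₀ : 0 < max 1 R := zero_lt_one.trans_le (le_max_left _ _)
  refine ⟨-Real.log (max ρ (1 / 2)) / max 1 R, div_pos hκ0 hR₀, fun n =>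
    ⟨2 * (2 * Real.sqrt N) ^ 2 * (n : ℝ) ^ 2 * exp (-Real.log (max ρ (1 / 2))), ?_⟩⟩
  intro F₁ F₂ Λ₁ Λ₂ K₁ K₂ h₁ h₂ hdisj hF₁ hF₂
  exact perturbed_covariance_decay_of_isKRContraction hW hWb hsupp hKR hrow hρ hR μ hμ n F₁ F₂ Λ₁ Λ₂
    K₁ K₂ h₁ h₂ hdisj hF₁ hF₂

end Summit.Ventures.YMGap.RobustBall
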